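import Literature.NumberTheory.Automorphic.SLTwoTreeQuadraticTorusShellSeam    -- ★ part IV (A-p17 (g23), R1LL-WILD (W′1)) p843967: parts I–III in its closure
import Literature.GroupTheory.FixedPointsOrbitMapTransport                 -- ★ B-p14 (g33) (W′2)-A p843911: `exists_equiv_quotient_orbitMap`
import HarnessLib

/-!
# The non-split quadratic torus on the tree of `SL₂(F)`, V-a (ORBIT HALF): the integral torus as a centraliser and the orbit equivalence `TK ⧸ TK(m) ≃ TK · x_m`
# (Labesse–Langlands 1979, §2 p. 8: the shells as `T`-orbits, `δ_m = [T : …]`)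

Topic `NumberTheory/Automorphic`; namespace `Literature.NumberTheory.Automorphic.HermitianLatticeTree` (ROAD W's).  KERNEL mathematics only: theorems, no definition, no
named fact, no instance, no notation, no `sorry`.  Cell `pub/hodgecm-mathlib` (D-0151), crux H413 = `stmt-HodgeConjecture-24833`, line «N6nsGerm», road «W′» = «R1LL-WILD»
(LEAD F0P3a-plan (g10) WORD T9-25; architect A-p16 (g28), RULINGS A-38 (c) ∕ A-40 (a): the brick (W′1)-V «SHELL CARDINALITIES» is SPLIT — (V-ORBIT) this file (A-p17 (g23)),
(V-INDEX) A-p01 (g21): the one number `[TK : TK(m)] = q^m`).  Census `A-provers/A-p17/g23/CENSUS-W1prime-V-ShellCardinalities.A-p17g23.md`.  Parts I–IV = ★ p843889 ∕ p843931 ∕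
p843948 ∕ p843967.
HONEST LABEL: HC_CM is proved only modulo the cell's 2 remaining named inputs (hLiu418, h413) until rung 0 closes; nothing printed is asserted here — elementary lattice and
group bookkeeping over a discrete valuation ring.

THE MATHEMATICS (notation of parts I–IV; `↑γτ = (0, v; 1, u)` the companion matrix of `τ`, `r m = diag(1, ϖ^m)` the shell representatives, `x_m = r m · v₀`).  NO definition is
introduced: the INTEGRAL TORUS is the explicit subgroup **`TK := Subgroup.centralizer {γτ} ⊓ glInt 2 F`** of `GL₂(F)` and the STABILISER OF THE SHELL-`m` REPRESENTATIVE in it is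
**`TK(m) := TK ⊓ (glInt 2 F).map (MulAut.conj (r m))`** (B-p14 (g32)'s level notation).
* §12 `mem_centralizer_companion_iff`: **`t ∈ centralizer {γτ} ⟺ ↑t = (c, ev; e, c + eu)`** for some `c e` — the torus IS the centraliser of the companion matrix (a
  non-scalar `2 × 2` matrix has commutant `F[γτ]`). Hence `t ∈ TK ⟺` torus shape with `c e ∈ 𝒪`, `|det t| = 1` (a UNIT of the order `𝒪 ⊕ 𝒪τ`).
* §13 `mem_map_conj_shellRep_iff_of_mem` : for `t ∈ TK`, **`t ∈ (glInt).map (conj (r m)) ⟺ t · x_m = x_m ⟺ |e| ≤ |ϖ|^m`** (★ I `glVertexAct_glVertexAct_eq_iff_mem_glInt` ∕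
  `glVertexAct_torus_shell_eq_iff`): `TK(m)` = the units of the order `𝒪 ⊕ ϖ^m 𝒪τ`.
* §14 **THE ORBIT EQUIVALENCE** `exists_equiv_quotient_torusInt_orbit`: `↥TK ⧸ TK(m) ≃ TK · x_m` (★ (W′2)-A `exists_equiv_quotient_orbitMap` at the orbit map `t ↦ t · x_m`), so
  `Nat.card (TK · x_m) = TK(m).relIndex TK` (`ncard_torusInt_orbit_eq_relIndex`).
* (sequel `SLTwoTreeQuadraticTorusShellCount`, same seat: at a RAMIFIED place the shell is the disjoint union of the two `TK`-orbits `TK · x_m ⊔ π · (TK · x_m)`, hence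
  `#{x | d x = m} = 2 · [TK : TK(m)]` = LL's `δ_m = 2q^m` with (V-INDEX)'s `[TK : TK(m)] = q^m`, A-p01 (g21).)
NOT here: the value of the index ((V-INDEX), A-p01 (g21)).

## References
* [LabesseLanglands1979] J.-P. Labesse, R. P. Langlands, *L-indistinguishability for SL(2)*, Canad. J. Math. 31 (1979), §2 p. 8 (`δ_m = [T(F) : …] = 2q^m` if `L` is ramified).
* [Serre1980Trees] J.-P. Serre, *Trees* (1980), Ch. I §6.1 (orbit–stabiliser on a `Γ`-tree), Ch. II §1.1–§1.3.
-/

set_option autoImplicit false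

noncomputable section

open scoped ValuativeRel Matrix MatrixGroups
open Matrix ValuativeRel

namespace Literature.NumberTheory.Automorphic.HermitianLatticeTree

open Literature.NumberTheory.Automorphic Literature.NumberTheory.LocalFields

variable {F : Type*} [Field F] [ValuativeRel F] {ϖ : F} (hϖ : IsUniformizingElement ϖ) [IsDiscreteValuationRing 𝒪[F]]

/-! ## §12 The torus is the centraliser of the companion matrix; the integral torus `TK` -/

omit [ValuativeRel F] [IsDiscreteValuationRing 𝒪[F]] in
/-- **THE TORUS IS THE CENTRALISER OF THE COMPANION MATRIX**: `t` commutes with `γτ = (0, v; 1, u)` iff `↑t = (c, ev; e, c + eu)` for some `c, e` (the commutant of a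
non-scalar `2 × 2` matrix is the algebra it generates, `F[τ]`). [cite: LabesseLanglands1979, §2 p. 7] -/
theorem mem_centralizer_companion_iff {u v : F} {γτ : GL (Fin 2) F} (hγτ : (γτ : Matrix (Fin 2) (Fin 2) F) = !![0, v; 1, u]) (t : GL (Fin 2) F) :
    t ∈ Subgroup.centralizer ({γτ} : Set (GL (Fin 2) F)) ↔ ∃ c e : F, (t : Matrix (Fin 2) (Fin 2) F) = !![c, e * v; e, c + e * u] := by
  rw [Subgroup.mem_centralizer_singleton_iff]
  constructor
  · intro h
    have heta := Matrix.eta_fin_two (t : Matrix (Fin 2) (Fin 2) F)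
    set p := (t : Matrix (Fin 2) (Fin 2) F) 0 0
    set q := (t : Matrix (Fin 2) (Fin 2) F) 0 1
    set r := (t : Matrix (Fin 2) (Fin 2) F) 1 0
    set s := (t : Matrix (Fin 2) (Fin 2) F) 1 1
    have hM : !![p, q; r, s] * !![0, v; 1, u] = !![0, v; 1, u] * !![p, q; r, s] := by
      rw [← heta, ← hγτ, ← Units.val_mul, ← Units.val_mul, h]
    rw [Matrix.mul_fin_two, Matrix.mul_fin_two] at hM
    have h00 : q = v * r := by simpa using congrFun (congrFun hM 0) 0
    have h10 : s = p + u * r := by simpa using congrFun (congrFun hM 1) 0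
    refine ⟨p, r, ?_⟩
    rw [heta, h00, h10]
    ext i j
    fin_cases i <;> fin_cases j <;> simp [mul_comm]
  · rintro ⟨c, e, ht⟩
    have h1 : ((γτ : GL (Fin 2) F) : Matrix (Fin 2) (Fin 2) F) = !![0, 1 * v; 1, 0 + 1 * u] := by rw [hγτ]; simp
    exact quadTorus_mul_comm ht h1

omit [IsDiscreteValuationRing 𝒪[F]] in
/-- **MEMBERSHIP IN THE INTEGRAL TORUS `TK = centralizer {γτ} ⊓ GL₂(𝒪)`**: `t ∈ TK` iff `↑t = (c, ev; e, c + eu)` with `c, e ∈ 𝒪` and `|det t| = 1` — a unit of the order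
`𝒪 ⊕ 𝒪τ` (for `u v ∈ 𝒪`). [cite: LabesseLanglands1979, §2 p. 8] -/
theorem mem_centralizer_inf_glInt_iff {u v : F} (hu : u ∈ 𝒪[F]) (hv : v ∈ 𝒪[F]) {γτ : GL (Fin 2) F} (hγτ : (γτ : Matrix (Fin 2) (Fin 2) F) = !![0, v; 1, u])
    (t : GL (Fin 2) F) :
    t ∈ Subgroup.centralizer ({γτ} : Set (GL (Fin 2) F)) ⊓ glInt 2 F ↔
      ∃ c e : F, c ∈ 𝒪[F] ∧ e ∈ 𝒪[F] ∧ (t : Matrix (Fin 2) (Fin 2) F) = !![c, e * v; e, c + e * u] ∧ valuation F (t : Matrix (Fin 2) (Fin 2) F).det = 1 := by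
  rw [Subgroup.mem_inf, mem_centralizer_companion_iff hγτ]
  constructor
  · rintro ⟨⟨c, e, ht⟩, hK⟩
    have hint := isIntegralMatrix_of_mem_glInt hK
    refine ⟨c, e, ?_, ?_, ht, valuation_det_eq_one_of_mem_glInt hK⟩
    · simpa [ht] using hint 0 0
    · simpa [ht] using hint 1 0
  · rintro ⟨c, e, hc, he, ht, hdet⟩
    refine ⟨⟨c, e, ht⟩, mem_glInt_of_isIntegralMatrix (fun i j => ?_) hdet⟩
    rw [ht]
    fin_cases i <;> fin_cases j
    · exact hc
    · exact mul_mem he hv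
    · exact he
    · exact add_mem hc (mul_mem he hu)

/-! ## §13 The stabiliser of the shell-`m` representative inside `TK` -/

include hϖ in
/-- **`t ∈ (GL₂(𝒪)).map (conj (r m)) ⟺ t · x_m = x_m`** for `t` of determinant valuation `1` (the conjugate `r_m GL₂(𝒪) r_m⁻¹` is the stabiliser of `x_m = r m · v₀` among
determinant-unit elements; ★ I `glVertexAct_glVertexAct_eq_iff_mem_glInt`). [cite: Serre1980Trees, Ch. II §1.3] -/
theorem mem_map_conj_iff_glVertexAct_eq (rm t : GL (Fin 2) F) (ht : valuation F (t : Matrix (Fin 2) (Fin 2) F).det = 1)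
    (v₀ : {M : Submodule 𝒪[F] (Fin 2 → F) // IsSpecialLattice (RingHom.id F) ϖ !![(0 : F), 1; -1, 0] M})
    (hv₀ : v₀.1 = latt (1 : Matrix (Fin 2) (Fin 2) F)) :
    t ∈ (glInt 2 F).map (MulAut.conj rm).toMonoidHom ↔ glVertexAct hϖ t (glVertexAct hϖ rm v₀) = glVertexAct hϖ rm v₀ := by
  rw [Subgroup.mem_map_equiv, MulAut.conj_symm_apply, glVertexAct_glVertexAct_eq_iff_mem_glInt hϖ rm t ht v₀ hv₀]

include hϖ in
/-- **`TK(m)` IS THE UNIT GROUP OF THE ORDER `𝒪 ⊕ ϖ^m 𝒪 τ`**: for `t ∈ TK` with `↑t = (c, ev; e, c + eu)`, `t ∈ (GL₂(𝒪)).map (conj (r m)) ⟺ |e| ≤ |ϖ|^m`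
(★ I `glVertexAct_torus_shell_eq_iff` at `t := 1`). [cite: LabesseLanglands1979, §2 p. 8] -/
theorem mem_map_conj_shellRep_iff_valuation_le {u v c e : F} (hu : u ∈ 𝒪[F]) (hv : v ∈ 𝒪[F]) (hc : c ∈ 𝒪[F]) (he : e ∈ 𝒪[F])
    {t rm : GL (Fin 2) F} (ht : (t : Matrix (Fin 2) (Fin 2) F) = !![c, e * v; e, c + e * u]) (hdet : valuation F (t : Matrix (Fin 2) (Fin 2) F).det = 1)
    {m : ℕ} (hrm : (rm : Matrix (Fin 2) (Fin 2) F) = Matrix.diagonal ![1, ϖ ^ m])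
    (v₀ : {M : Submodule 𝒪[F] (Fin 2 → F) // IsSpecialLattice (RingHom.id F) ϖ !![(0 : F), 1; -1, 0] M})
    (hv₀ : v₀.1 = latt (1 : Matrix (Fin 2) (Fin 2) F)) :
    t ∈ (glInt 2 F).map (MulAut.conj rm).toMonoidHom ↔ valuation F e ≤ valuation F ϖ ^ m := by
  have h1 : ((1 : GL (Fin 2) F) : Matrix (Fin 2) (Fin 2) F) = !![1, 0 * v; 0, 1 + 0 * u] := by rw [Units.val_one, Matrix.one_fin_two]; simp
  rw [mem_map_conj_iff_glVertexAct_eq hϖ rm t hdet v₀ hv₀, ← one_mul rm]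
  exact glVertexAct_torus_shell_eq_iff hϖ hu hv hc he ht hdet h1 hrm v₀ hv₀

/-! ## §14 The orbit equivalence `TK ⧸ TK(m) ≃ TK · x_m` -/

include hϖ in
/-- Two integral-torus elements give the same shell-`m` vertex iff they differ by the stabiliser: for `a b ∈ TK`,
`a · x_m = b · x_m ⟺ a⁻¹ b ∈ (GL₂(𝒪)).map (conj (r m))`. [cite: Serre1980Trees, Ch. I §6.1] -/
theorem glVertexAct_shellRep_eq_iff_inv_mul_mem {γτ : GL (Fin 2) F} (rm : GL (Fin 2) F) {a b : GL (Fin 2) F}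
    (ha : a ∈ Subgroup.centralizer ({γτ} : Set (GL (Fin 2) F)) ⊓ glInt 2 F) (hb : b ∈ Subgroup.centralizer ({γτ} : Set (GL (Fin 2) F)) ⊓ glInt 2 F)
    (v₀ : {M : Submodule 𝒪[F] (Fin 2 → F) // IsSpecialLattice (RingHom.id F) ϖ !![(0 : F), 1; -1, 0] M})
    (hv₀ : v₀.1 = latt (1 : Matrix (Fin 2) (Fin 2) F)) :
    glVertexAct hϖ (a * rm) v₀ = glVertexAct hϖ (b * rm) v₀ ↔ a⁻¹ * b ∈ (glInt 2 F).map (MulAut.conj rm).toMonoidHom := by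
  have hab : valuation F (((a⁻¹ * b : GL (Fin 2) F)) : Matrix (Fin 2) (Fin 2) F).det = 1 :=
    valuation_det_eq_one_of_mem_glInt (mul_mem (inv_mem (Subgroup.mem_inf.1 ha).2) (Subgroup.mem_inf.1 hb).2)
  rw [mem_map_conj_iff_glVertexAct_eq hϖ rm (a⁻¹ * b) hab v₀ hv₀, glVertexAct_mul, glVertexAct_mul]
  constructor
  · intro h
    rw [glVertexAct_mul, ← h, ← glVertexAct_mul, inv_mul_cancel, glVertexAct_one]
  · intro h
    have h' := congrArg (glVertexAct hϖ a) h
    rw [← glVertexAct_mul, mul_inv_cancel_left] at h'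
    exact h'.symm

include hϖ in
/-- **THE ORBIT EQUIVALENCE** (orbit–stabiliser inside the integral torus): `↥TK ⧸ TK(m) ≃ TK · x_m`, `t TK(m) ↦ t · x_m`, where `TK · x_m` is the set of vertices
`{x | ∃ t ∈ TK, t · r m · v₀ = x}` (★ (W′2)-A `exists_equiv_quotient_orbitMap`). [cite: Serre1980Trees, Ch. I §6.1] [cite: LabesseLanglands1979, §2 p. 8] -/
theorem exists_equiv_quotient_torusInt_orbit {γτ : GL (Fin 2) F} (rm : GL (Fin 2) F)
    (v₀ : {M : Submodule 𝒪[F] (Fin 2 → F) // IsSpecialLattice (RingHom.id F) ϖ !![(0 : F), 1; -1, 0] M})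
    (hv₀ : v₀.1 = latt (1 : Matrix (Fin 2) (Fin 2) F)) :
    ∃ Φ : (↥(Subgroup.centralizer ({γτ} : Set (GL (Fin 2) F)) ⊓ glInt 2 F) ⧸
        ((Subgroup.centralizer ({γτ} : Set (GL (Fin 2) F)) ⊓ glInt 2 F ⊓ (glInt 2 F).map (MulAut.conj rm).toMonoidHom).subgroupOf
          (Subgroup.centralizer ({γτ} : Set (GL (Fin 2) F)) ⊓ glInt 2 F))) ≃
        {x : {M : Submodule 𝒪[F] (Fin 2 → F) // IsSpecialLattice (RingHom.id F) ϖ !![(0 : F), 1; -1, 0] M} //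
          ∃ t ∈ Subgroup.centralizer ({γτ} : Set (GL (Fin 2) F)) ⊓ glInt 2 F, glVertexAct hϖ (t * rm) v₀ = x},
      ∀ t : ↥(Subgroup.centralizer ({γτ} : Set (GL (Fin 2) F)) ⊓ glInt 2 F), (Φ (QuotientGroup.mk t)).1 = glVertexAct hϖ ((t : GL (Fin 2) F) * rm) v₀ := by
  let f : ↥(Subgroup.centralizer ({γτ} : Set (GL (Fin 2) F)) ⊓ glInt 2 F) →
      {x : {M : Submodule 𝒪[F] (Fin 2 → F) // IsSpecialLattice (RingHom.id F) ϖ !![(0 : F), 1; -1, 0] M} //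
          ∃ t ∈ Subgroup.centralizer ({γτ} : Set (GL (Fin 2) F)) ⊓ glInt 2 F, glVertexAct hϖ (t * rm) v₀ = x} :=
    fun t => ⟨glVertexAct hϖ ((t : GL (Fin 2) F) * rm) v₀, t, t.2, rfl⟩
  have hf : ∀ a b, f a = f b ↔ a⁻¹ * b ∈ ((Subgroup.centralizer ({γτ} : Set (GL (Fin 2) F)) ⊓ glInt 2 F ⊓
      (glInt 2 F).map (MulAut.conj rm).toMonoidHom).subgroupOf (Subgroup.centralizer ({γτ} : Set (GL (Fin 2) F)) ⊓ glInt 2 F)) := by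
    intro a b
    rw [Subtype.mk.injEq, glVertexAct_shellRep_eq_iff_inv_mul_mem hϖ rm a.2 b.2 v₀ hv₀, Subgroup.mem_subgroupOf, Subgroup.coe_mul, Subgroup.coe_inv,
      Subgroup.mem_inf]
    exact ⟨fun h => ⟨mul_mem (inv_mem a.2) b.2, h⟩, fun h => h.2⟩
  have hs : Function.Surjective f := by
    rintro ⟨x, t, ht, rfl⟩
    exact ⟨⟨t, ht⟩, rfl⟩
  obtain ⟨Φ, hΦ⟩ := Literature.GroupTheory.exists_equiv_quotient_orbitMap _ f hf hs
  exact ⟨Φ, fun t => by rw [hΦ]⟩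

include hϖ in
/-- **THE ORBIT COUNT**: `#(TK · x_m) = [TK : TK(m)]` (as `Set.ncard` and `Subgroup.relIndex`; both are `0` when infinite). [cite: Serre1980Trees, Ch. I §6.1]
[cite: LabesseLanglands1979, §2 p. 8] -/
theorem ncard_torusInt_orbit_eq_relIndex {γτ : GL (Fin 2) F} (rm : GL (Fin 2) F)
    (v₀ : {M : Submodule 𝒪[F] (Fin 2 → F) // IsSpecialLattice (RingHom.id F) ϖ !![(0 : F), 1; -1, 0] M})
    (hv₀ : v₀.1 = latt (1 : Matrix (Fin 2) (Fin 2) F)) :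
    {x : {M : Submodule 𝒪[F] (Fin 2 → F) // IsSpecialLattice (RingHom.id F) ϖ !![(0 : F), 1; -1, 0] M} |
        ∃ t ∈ Subgroup.centralizer ({γτ} : Set (GL (Fin 2) F)) ⊓ glInt 2 F, glVertexAct hϖ (t * rm) v₀ = x}.ncard =
      (Subgroup.centralizer ({γτ} : Set (GL (Fin 2) F)) ⊓ glInt 2 F ⊓ (glInt 2 F).map (MulAut.conj rm).toMonoidHom).relIndex
        (Subgroup.centralizer ({γτ} : Set (GL (Fin 2) F)) ⊓ glInt 2 F) := by
  obtain ⟨Φ, -⟩ := exists_equiv_quotient_torusInt_orbit hϖ rm v₀ hv₀ (γτ := γτ)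
  rw [Subgroup.relIndex, Subgroup.index, ← Nat.card_coe_set_eq]
  exact Nat.card_congr Φ.symm

end Literature.NumberTheory.Automorphic.HermitianLatticeTree

end
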